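import Literature.Geometry.Lorentzian.KillingHorizonShadowAlong
import Literature.Geometry.Lorentzian.AxisymmetricBlackHoleUniquenessProofs
import Literature.Geometry.Lorentzian.StaticBlackHoleUniquenessProofs
import Literature.Geometry.Lorentzian.LorentzianMetricProofs
import Literature.Geometry.Lorentzian.CausalityOpennessProofs
import Literature.Geometry.Lorentzian.IPlusRegular

/-!
# Stub `stub_axialCollar_ne_zero` (P2) of crux `HawkingExtensionIsKerr`, line `SketchIdeator2`

In the rotating branch of the lead skeleton a named fact hands constants `a`, `b` (`b ≠ 0`) such
that `Φ := a • T + b • K'` (`T = 𝓑.killing`, `K'` a Killing field of the d.o.c. equal to the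
collar field `K` on `U' ∩ ⟨⟨M_ext⟩⟩`, `K` timelike on `U ∩ ⟨⟨M_ext⟩⟩`) has through every point of
`⟨⟨M_ext⟩⟩` a whole-line integral curve staying in `⟨⟨M_ext⟩⟩` which is `2π`-periodic.  This
stub: `a ≠ 0`.

Proof.  Suppose `a = 0`, so `Φ = b • K'`, a Killing field of the open set `⟨⟨M_ext⟩⟩`
(`IsKillingFieldOn.smul`).  The horizon `𝓔⁺` is non-empty (connected) and contained in
`closure ⟨⟨M_ext⟩⟩` (`StationaryAFBlackHole.horizon_subset_closure_doc`), so the neighbourhood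
`U ∩ U'` of a horizon point meets `⟨⟨M_ext⟩⟩` in some `x`, where `Φ x = b • K x` is timelike
(`b ≠ 0`).  Let `γ` be the periodic integral curve of `Φ` through `x` inside `⟨⟨M_ext⟩⟩`.  Along
`γ` the norm `g(Φ, Φ)` is constant (its derivative is the Killing equation of `Φ` at the points
`γ t ∈ ⟨⟨M_ext⟩⟩`, `stub_axialCollar_val_self_apply_eq`), so `Φ ∘ γ = γ'` is timelike throughout and
keeps its time orientation (a causal vector is never orthogonal to the orienting timelike field;
intermediate value theorem, `stub_axialCollar_isFutureDirected_apply`).  Hence `γ|[0, 2π]` or its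
reversal is a closed future causal curve through `x`, contradicting strong causality at the
d.o.c. point `x` (`IsIPlusRegular.isStronglyCausalAt`,
`IsStronglyCausalAt.apply_ne_of_isFutureCausalCurveOn`).  This is the proof of
`PseudoRiemannianMetric.IsKillingField.isSpacelike_apply_of_periodic_of_isStronglyCausalAt`
(`AxisymmetricBlackHoleUniquenessProofs.lean`) with the global Killing hypothesis replaced by
"Killing on an open set containing the orbit", in the timelike case (where no uniqueness of
integral curves is needed to exclude zeros of the field along the orbit).
-/

noncomputable section

set_option linter.dupNamespace false

namespace Summit.FinalStateConjecture.FinalStateConjecture.Theorems.HawkingExtensionIsKerr.SketchIdeator2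

open Set Function Bundle Literature.Geometry.Lorentzian
open scoped Manifold ContDiff Topology

section KillingOnOrbits

variable {E : Type*} [NormedAddCommGroup E] [NormedSpace ℝ E] {H : Type*} [TopologicalSpace H]
  {I : ModelWithCorners ℝ E H} {M : Type*} [TopologicalSpace M] [ChartedSpace H M]
  [IsManifold I ∞ M] {n : ℕ∞ω} [FiniteDimensional ℝ E] [CompleteSpace E] [Fact (1 ≤ n)]

/-- **`g(Y, Y)` is constant along an orbit of a local Killing field.**  If `Y` is a Killing field
of `g` on an open set `U` and `γ` is an integral curve of `Y` contained in `U`, then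
`g(Y, Y)(γ s) = g(Y, Y)(γ t)`: the derivative of `t ↦ g_{γ t}(Y, Y)` is
`dg(Y,Y)_{γ t}(Y) = 2 g(∇_Y Y, Y)(γ t) = 0` by metric compatibility and the Killing equation at
`γ t ∈ U` (local form of `IsKillingField.val_self_apply_eq_of_isMIntegralCurve`). [folklore] -/
private theorem stub_axialCollar_val_self_apply_eq
    {g : PseudoRiemannianMetric I n E (TangentSpace I : M → Type _)} [g.HasLeviCivita]
    {Y : Π x : M, TangentSpace I x} {U : Set M} (hY : g.IsKillingFieldOn Y U) (hU : IsOpen U)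
    {γ : ℝ → M} (hγ : IsMIntegralCurve γ Y) (hγU : ∀ t, γ t ∈ U) (s t : ℝ) :
    g.val (γ s) (Y (γ s)) (Y (γ s)) = g.val (γ t) (Y (γ t)) (Y (γ t)) := by
  have hLC : g.IsLeviCivita g.leviCivita := PseudoRiemannianMetric.isLeviCivita_leviCivita_holds
  have hd : ∀ t, HasDerivAt (fun t' ↦ g.val (γ t') (Y (γ t')) (Y (γ t'))) 0 t := by
    intro t
    have hYd : MDiffAt (T% Y) (γ t) := hY.mdifferentiableAt hU (hγU t)
    have hf : MDiffAt (fun y ↦ g.val y (Y y) (Y y)) (γ t) := g.mdifferentiableAt_val_apply hYd hYd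
    have h1 := Literature.Geometry.Lorentzian.hasDerivAt_comp_curve hf (hγ t).mdifferentiableAt
    rw [velocity_eq_of_isMIntegralCurve hγ t] at h1
    have h0 : mvfderiv I (fun y ↦ g.val y (Y y) (Y y)) (γ t) (Y (γ t)) = 0 := by
      rw [hLC.2 hYd hYd hYd]
      exact hY.val_leviCivita_add (hγU t) _ _
    have h0' : mfderiv I 𝓘(ℝ, ℝ) (fun y ↦ g.val y (Y y) (Y y)) (γ t) (Y (γ t)) = 0 := h0
    rwa [h0'] at h1
  exact is_const_of_deriv_eq_zero (fun t ↦ (hd t).differentiableAt) (fun t ↦ (hd t).deriv) s t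

/-- **Along an orbit of a local Killing field a future-directed timelike value persists.**  If `Y`
is Killing on an open `U ⊇ γ(ℝ)`, `γ` an integral curve of `Y`, and `Y (γ 0)` is timelike and
future-directed, then `Y (γ t)` is future-directed for every `t`: `g(Y, Y)` is constant along `γ`
(`stub_axialCollar_val_self_apply_eq`), so `Y (γ t)` is timelike for all `t`; the continuous
function `t ↦ g(τ, Y)(γ t)` never vanishes (a causal vector is never orthogonal to the timelike
orienting field) and is negative at `t = 0`, hence everywhere (intermediate value theorem).
Local form of `IsKillingField.isFutureDirected_apply_of_isMIntegralCurve`. [folklore] -/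
private theorem stub_axialCollar_isFutureDirected_apply
    {g : LorentzianMetric I n M} [g.HasLeviCivita] {τ : TimeOrientation g}
    {Y : Π x : M, TangentSpace I x} {U : Set M}
    (hY : g.toPseudoRiemannianMetric.IsKillingFieldOn Y U) (hU : IsOpen U)
    {γ : ℝ → M} (hγ : IsMIntegralCurve γ Y) (hγU : ∀ t, γ t ∈ U)
    (h0 : g.IsTimelike (Y (γ 0))) (h0f : τ.IsFutureDirected (Y (γ 0))) (t : ℝ) :
    τ.IsFutureDirected (Y (γ t)) := by
  have htl : ∀ s, g.IsTimelike (Y (γ s)) := fun s ↦ by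
    rw [LorentzianMetric.isTimelike_iff, stub_axialCollar_val_self_apply_eq hY hU hγ hγU s 0]
    exact h0
  set f : ℝ → ℝ := fun s ↦ g.val (γ s) (τ.vectorField (γ s)) (Y (γ s)) with hf
  have hfc : Continuous f := continuous_iff_continuousAt.2 fun s ↦
    (g.contMDiffAt_val_apply le_rfl (τ.contMDiff (γ s))
      (hY.contMDiffAt hU (hγU s))).continuousAt.comp hγ.continuous.continuousAt
  have hfne : ∀ s, f s ≠ 0 := fun s ↦
    g.val_ne_zero_of_isTimelike_of_isCausal (τ.isTimelike _) (htl s).isCausal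
  have hf0 : f 0 < 0 := h0f.2
  refine ⟨(htl t).isCausal, ?_⟩
  by_contra hft
  have hft' : 0 ≤ f t := le_of_not_gt hft
  have hmem : (0 : ℝ) ∈ Set.Icc (f 0) (f t) := ⟨hf0.le, hft'⟩
  obtain ⟨s, hs⟩ := intermediate_value_univ (a := 0) (b := t) hfc hmem
  exact hfne s hs

/-- **Along an orbit of a local Killing field a past-directed timelike value persists** (the
previous statement for the reversed time orientation). [folklore] -/
private theorem stub_axialCollar_isPastDirected_apply
    {g : LorentzianMetric I n M} [g.HasLeviCivita] {τ : TimeOrientation g}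
    {Y : Π x : M, TangentSpace I x} {U : Set M}
    (hY : g.toPseudoRiemannianMetric.IsKillingFieldOn Y U) (hU : IsOpen U)
    {γ : ℝ → M} (hγ : IsMIntegralCurve γ Y) (hγU : ∀ t, γ t ∈ U)
    (h0 : g.IsTimelike (Y (γ 0))) (h0p : τ.IsPastDirected (Y (γ 0))) (t : ℝ) :
    τ.IsPastDirected (Y (γ t)) := by
  rw [← TimeOrientation.isFutureDirected_reverse_iff] at h0p ⊢
  exact stub_axialCollar_isFutureDirected_apply hY hU hγ hγU h0 h0p t

/-- **A local Killing field with a closed orbit through a strongly causal point is not timelike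
there.**  If `Y` is Killing on an open `U`, `γ ⊆ U` is an integral curve of `Y` which is
`T`-periodic (`T > 0`), and strong causality holds at `γ 0`, then `Y (γ 0)` is not timelike:
otherwise it is future- or past-directed; in the first case `γ|[0, T]` is a closed future causal
curve through `γ 0` (`stub_axialCollar_isFutureDirected_apply`), in the second the reversed curve
`t ↦ γ (-t)` (an integral curve of `-Y`) is, and either contradicts strong causality at `γ 0`
(`IsStronglyCausalAt.apply_ne_of_isFutureCausalCurveOn`).  Local, timelike form of
`IsKillingField.isSpacelike_apply_of_periodic_of_isStronglyCausalAt`. [folklore] -/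
private theorem stub_axialCollar_not_isTimelike_of_periodic [T1Space M]
    {g : LorentzianMetric I n M} [g.HasLeviCivita] {τ : TimeOrientation g}
    {Y : Π x : M, TangentSpace I x} {U : Set M}
    (hY : g.toPseudoRiemannianMetric.IsKillingFieldOn Y U) (hU : IsOpen U)
    {γ : ℝ → M} (hγ : IsMIntegralCurve γ Y) (hγU : ∀ t, γ t ∈ U) {T : ℝ} (hT : 0 < T)
    (hper : Function.Periodic γ T) (hsc : g.IsStronglyCausalAt τ (γ 0)) :
    ¬ g.IsTimelike (Y (γ 0)) := by
  intro htl
  rcases τ.isFutureDirected_or_isPastDirected_of_isCausal htl.isCausal with hfut | hpast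
  · -- `γ|[0, T]` is a closed future causal curve through `γ 0`
    have hcurve : g.IsFutureCausalCurveOn τ γ (Set.Icc 0 T) := fun t _ ↦
      ⟨(hγ t).mdifferentiableAt, by
        rw [velocity_eq_of_isMIntegralCurve hγ t]
        exact stub_axialCollar_isFutureDirected_apply hY hU hγ hγU htl hfut t⟩
    have hclosed : γ T = γ 0 := by simpa using hper 0
    exact hsc.apply_ne_of_isFutureCausalCurveOn hT hcurve rfl hclosed
  · -- the reversed curve `t ↦ γ (-t)`, an integral curve of `-Y`, is a closed future causal curve
    have hδ : IsMIntegralCurve (γ ∘ (· * (-1 : ℝ))) ((-1 : ℝ) • Y) := hγ.comp_mul (-1)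
    have hcurve : g.IsFutureCausalCurveOn τ (γ ∘ (· * (-1 : ℝ))) (Set.Icc 0 T) := fun t _ ↦
      ⟨(hδ t).mdifferentiableAt, by
        rw [velocity_eq_of_isMIntegralCurve hδ t, Pi.smul_apply, neg_one_smul,
          TimeOrientation.isFutureDirected_neg_iff]
        exact stub_axialCollar_isPastDirected_apply hY hU hγ hγU htl hpast _⟩
    have h0 : (γ ∘ (· * (-1 : ℝ))) 0 = γ 0 := by simp
    have hclosed : (γ ∘ (· * (-1 : ℝ))) T = γ 0 := by
      have h := hper (-T)
      rw [neg_add_cancel] at h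
      simpa using h.symm
    exact hsc.apply_ne_of_isFutureCausalCurveOn hT hcurve h0 hclosed

end KillingOnOrbits

/-- **Stub P2 (worker): the coefficient of `T` in the axisymmetric combination is non-zero.**  If
`Φ = a T + b K'` (`b ≠ 0`) has closed (`2π`-periodic) orbits inside the d.o.c. and `a = 0`, then
`Φ = b • K'` is a Killing field of the (open) d.o.c. with a closed orbit through a point `x` of
`U ∩ U' ∩ ⟨⟨M_ext⟩⟩` near `𝓔⁺ ≠ ∅` (`𝓔⁺ ⊆ closure ⟨⟨M_ext⟩⟩`), where `Φ x = b • K x` is timelike;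
`g(Φ, Φ)` is constant along the orbit, which is therefore a closed timelike curve through the
strongly causal point `x` of `⟨⟨M_ext⟩⟩` (`IsIPlusRegular`) — a contradiction
(`stub_axialCollar_not_isTimelike_of_periodic`). -/
theorem stub_axialCollar_ne_zero :
    ∀ (𝓑 : StationaryAFBlackHole.{0}) [𝓑.metric.HasLeviCivita]
      (U U' : Set 𝓑.carrier) (K K' : Π x : 𝓑.carrier, TangentSpace (𝓡 4) x) (a b : ℝ),
      𝓑.IsIPlusRegular → IsConnected 𝓑.horizon →
      IsOpen U → 𝓑.horizon ⊆ U → 𝓑.metric.toPseudoRiemannianMetric.IsKillingFieldOn K U →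
      (∀ x ∈ U ∩ 𝓑.doc, 𝓑.metric.val x (K x) (K x) < 0) →
      IsOpen U' → 𝓑.horizon ⊆ U' → (∀ x ∈ U' ∩ 𝓑.doc, K' x = K x) →
      𝓑.metric.toPseudoRiemannianMetric.IsKillingFieldOn K' 𝓑.doc →
      b ≠ 0 →
      (∀ x ∈ 𝓑.doc, ∃ γ : ℝ → 𝓑.carrier, IsMIntegralCurve γ (a • 𝓑.killing + b • K') ∧
        γ 0 = x ∧ (∀ t, γ t ∈ 𝓑.doc) ∧ Function.Periodic γ (2 * Real.pi)) →
      a ≠ 0 := by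
  intro 𝓑 _ U U' K K' a b hreg hconn hU hHU _hKon hKtl hU' hHU' hK'K hK'on hb hper ha
  subst ha
  -- the d.o.c. is open and the (non-empty) horizon lies in its closure
  have hdoc : IsOpen 𝓑.doc :=
    𝓑.isOpen_doc LorentzianMetric.isOpen_chronologicalFuture_holds_of_boundaryless
      LorentzianMetric.isOpen_chronologicalPast_holds_of_boundaryless
  obtain ⟨p, hp⟩ := hconn.nonempty
  have hpcl : p ∈ closure 𝓑.doc :=
    𝓑.horizon_subset_closure_doc LorentzianMetric.isOpen_chronologicalFuture_holds_of_boundaryless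
      LorentzianMetric.isOpen_chronologicalPast_holds_of_boundaryless hp
  -- a point of `U ∩ U' ∩ doc`
  obtain ⟨x, ⟨hxU, hxU'⟩, hxdoc⟩ : ((U ∩ U') ∩ 𝓑.doc).Nonempty :=
    mem_closure_iff_nhds.mp hpcl _ ((hU.inter hU').mem_nhds ⟨hHU hp, hHU' hp⟩)
  -- with `a = 0` the combination is `b • K'`, a Killing field of the d.o.c.
  have hΦ : ((0 : ℝ) • 𝓑.killing + b • K' : Π y : 𝓑.carrier, TangentSpace (𝓡 4) y) = b • K' := by
    rw [zero_smul, zero_add]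
  rw [hΦ] at hper
  have hΦon : 𝓑.metric.toPseudoRiemannianMetric.IsKillingFieldOn (b • K') 𝓑.doc :=
    hK'on.smul hdoc b
  -- the closed orbit through `x`, inside the d.o.c.
  obtain ⟨γ, hγ, hγ0, hγdoc, hγper⟩ := hper x hxdoc
  have hsc : 𝓑.metric.IsStronglyCausalAt 𝓑.timeOrientation (γ 0) := by
    rw [hγ0]
    exact hreg.isStronglyCausalAt hxdoc
  -- `b • K' x = b • K x` is timelike
  have htl : 𝓑.metric.IsTimelike ((b • K') (γ 0)) := by
    rw [hγ0, LorentzianMetric.isTimelike_iff, Pi.smul_apply, hK'K x ⟨hxU', hxdoc⟩]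
    simp only [map_smul, smul_apply, smul_eq_mul, ← mul_assoc]
    exact mul_neg_of_pos_of_neg (mul_self_pos.mpr hb) (hKtl x ⟨hxU, hxdoc⟩)
  exact stub_axialCollar_not_isTimelike_of_periodic hΦon hdoc hγ hγdoc Real.two_pi_pos hγper hsc
    htl

end Summit.FinalStateConjecture.FinalStateConjecture.Theorems.HawkingExtensionIsKerr.SketchIdeator2

end
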